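import Mathlib.Analysis.InnerProductSpace.Spectrum
import HarnessLib

/-!
# The top of a compact positive self-adjoint operator: the level-`0` min–max value over a
# dense subspace is an attained eigenvalue

Topic `Literature/Analysis/OperatorTheory` (next to `CompactSelfAdjointBottom.lean`, which treats
the negative BOTTOM of the numerical range through `IsGLB`). Theorems only (no definition, no
named fact, no instance).

Let `T` be a compact self-adjoint operator on a nontrivial Hilbert space `G` over `𝕜 = ℝ` or `ℂ`
which is positive as a form, `0 ≤ Re ⟪x, T x⟫`, and let `D ⊆ G` be a dense subspace (a "core").
Put

  `λ₀ = sup {Re ⟪ψ, T ψ⟫ / ‖ψ‖² : ψ ∈ D, ψ ≠ 0}`   (the level-`0` min–max recipe over the core).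

Then (`exists_top_eigenvector_of_dense`) `λ₀` is an attained eigenvalue: there is a unit vector
`Ω` with `T Ω = λ₀ Ω`, and `Re ⟪x, T x⟫ ≤ λ₀ ‖x‖²` for EVERY `x ∈ G` (not only on the core); in
fact `λ₀ = ‖T‖` is the top of the spectrum (Reed–Simon IV, Thm. XIII.1, the min–max principle,
level `0`; Reed–Simon I, Thm. VI.16, the Hilbert–Schmidt theorem, for the attainment).

Proof. `‖T‖ = sup |Re ⟪T x, x⟫| / ‖x‖²` for a symmetric operator
(`ContinuousLinearMap.norm_eq_iSup_rayleighQuotient`) and the Rayleigh quotient is `≥ 0` here,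
so if `‖T‖` were in the resolvent set the Rayleigh quotient would stay below `‖T‖ - ε`
(`ContinuousLinearMap.rayleighQuotient_le_of_norm_mem_resolventSet`), a contradiction; hence
`‖T‖ ∈ σ(T)`, and a nonzero spectral value of a compact operator is an eigenvalue
(`IsCompactOperator.hasEigenvalue_iff_mem_spectrum`, the Fredholm alternative); if `T = 0` any
unit vector will do (`exists_eigenvector_norm_of_re_inner_nonneg`). The form bound
`Re ⟪x, T x⟫ ≤ ‖T‖ ‖x‖²` is Cauchy–Schwarz (`re_inner_apply_le_norm_mul_sq`). Finally the
supremum of the Rayleigh quotient over the nonzero vectors of a dense subspace equals `μ` as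
soon as `μ` bounds the form and is the eigenvalue of some unit eigenvector `Ω`
(`csSup_rayleigh_eq_of_dense`): `≤` is the bound, `≥` by evaluating the (continuous) Rayleigh
quotient at elements of `D` close to `Ω`.

What is NOT here: higher min–max levels (the level-`1` statement on `Ω^⊥` is a separate file),
and the non-positive case (for a compact self-adjoint `T ≤ 0` with infinitely many negative
eigenvalues the top `0` of the spectrum need not be attained, so positivity cannot be dropped).

## References

* M. Reed, B. Simon, *Methods of Modern Mathematical Physics IV: Analysis of Operators* (1978),
  Thm. XIII.1 (min–max principle). [ReedSimonIV1978]
* M. Reed, B. Simon, *Methods of Modern Mathematical Physics I: Functional Analysis* (1980),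
  Thm. VI.16 (Hilbert–Schmidt theorem). [ReedSimonI1980]
-/

noncomputable section

open scoped InnerProductSpace ComplexConjugate
open Filter _root_.Topology

namespace Literature.Analysis.OperatorTheory

section General

variable {𝕜 : Type*} [RCLike 𝕜] {G : Type*} [NormedAddCommGroup G] [InnerProductSpace 𝕜 G]

/-- **The form of a bounded operator is bounded by its norm**: `Re ⟪x, T x⟫ ≤ ‖T‖ ‖x‖²`
(Cauchy–Schwarz and `‖T x‖ ≤ ‖T‖ ‖x‖`). [folklore] -/
theorem re_inner_apply_le_norm_mul_sq (T : G →L[𝕜] G) (x : G) :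
    RCLike.re ⟪x, T x⟫_𝕜 ≤ ‖T‖ * ‖x‖ ^ 2 :=
  calc RCLike.re ⟪x, T x⟫_𝕜 ≤ ‖⟪x, T x⟫_𝕜‖ := RCLike.re_le_norm _
    _ ≤ ‖x‖ * ‖T x‖ := norm_inner_le_norm x (T x)
    _ ≤ ‖x‖ * (‖T‖ * ‖x‖) := by gcongr; exact T.le_opNorm x
    _ = ‖T‖ * ‖x‖ ^ 2 := by ring

/-- **The supremum of the Rayleigh quotient over a dense subspace.** If `Ω` is a unit vector
with `T Ω = μ Ω` and `Re ⟪x, T x⟫ ≤ μ ‖x‖²` for all `x`, then for every dense subspace `D` the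
supremum of `Re ⟪ψ, T ψ⟫ / ‖ψ‖²` over `ψ ∈ D`, `ψ ≠ 0` equals `μ`: it is at most `μ` by the bound,
and at least `μ` because the Rayleigh quotient is continuous at `Ω ≠ 0`, takes the value `μ`
there, and `D` comes arbitrarily close to `Ω` (the level-`0` case of the min–max principle over
a form core, Reed–Simon IV, Thm. XIII.1–2). [folklore] -/
theorem csSup_rayleigh_eq_of_dense {T : G →L[𝕜] G} {μ : ℝ} {Ω : G} (hΩ : ‖Ω‖ = 1)
    (hTΩ : T Ω = (μ : 𝕜) • Ω) (hle : ∀ x : G, RCLike.re ⟪x, T x⟫_𝕜 ≤ μ * ‖x‖ ^ 2)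
    {D : Submodule 𝕜 G} (hD : Dense (D : Set G)) :
    sSup ((fun ψ : G => RCLike.re ⟪ψ, T ψ⟫_𝕜 / ‖ψ‖ ^ 2) '' {ψ | ψ ∈ D ∧ ψ ≠ 0}) = μ := by
  set f : G → ℝ := fun ψ => RCLike.re ⟪ψ, T ψ⟫_𝕜 / ‖ψ‖ ^ 2 with hf
  -- the Rayleigh quotient is bounded by `μ` ...
  have hfle : ∀ ψ : G, ψ ≠ 0 → f ψ ≤ μ := fun ψ hψ => by
    have hpos : 0 < ‖ψ‖ ^ 2 := by positivity
    exact (div_le_iff₀ hpos).2 (hle ψ)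
  have hbdd : BddAbove (f '' {ψ | ψ ∈ D ∧ ψ ≠ 0}) := ⟨μ, by
    rintro _ ⟨ψ, hψ, rfl⟩
    exact hfle ψ hψ.2⟩
  -- ... takes the value `μ` at `Ω` ...
  have hΩ0 : Ω ≠ 0 := by
    rw [← norm_ne_zero_iff, hΩ]; exact one_ne_zero
  have hfΩ : f Ω = μ := by
    simp only [hf, hTΩ, inner_smul_right, inner_self_eq_norm_sq_to_K, hΩ]
    simp
  -- ... and is continuous at `Ω`
  have hcont : ContinuousAt f Ω := by
    refine ContinuousAt.div ?_ ((continuous_norm.pow 2).continuousAt) (by rw [hΩ]; norm_num)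
    exact (RCLike.continuous_re.comp (continuous_id.inner T.continuous)).continuousAt
  -- nonzero elements of `D` near `Ω`
  have hne0 : ∀ᶠ ψ in 𝓝 Ω, ψ ≠ 0 := eventually_ne_nhds hΩ0
  have hne : (f '' {ψ | ψ ∈ D ∧ ψ ≠ 0}).Nonempty := by
    obtain ⟨ψ, hψD, hψ0⟩ := hD.inter_nhds_nonempty hne0
    exact ⟨f ψ, ψ, ⟨hψD, hψ0⟩, rfl⟩
  refine le_antisymm (csSup_le hne ?_) (le_of_forall_lt fun c hc => ?_)
  · rintro _ ⟨ψ, hψ, rfl⟩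
    exact hfle ψ hψ.2
  · have hc' : c < f Ω := by rwa [hfΩ]
    have hev : ∀ᶠ ψ in 𝓝 Ω, c < f ψ := hcont.eventually_const_lt hc'
    obtain ⟨ψ, hψD, hψc, hψ0⟩ := hD.inter_nhds_nonempty (hev.and hne0)
    exact hψc.trans_le (le_csSup hbdd ⟨ψ, ⟨hψD, hψ0⟩, rfl⟩)

variable [CompleteSpace G]

/-- **The norm of a compact positive self-adjoint operator is an attained eigenvalue.** If `T`
is compact, self-adjoint and `0 ≤ Re ⟪x, T x⟫` on a nontrivial Hilbert space, there is a unit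
vector `Ω` with `T Ω = ‖T‖ Ω`: `‖T‖ = sup` of the (here nonnegative) Rayleigh quotient lies in
the spectrum, and a nonzero spectral value of a compact operator is an eigenvalue (Fredholm
alternative); for `T = 0` any unit vector works (Reed–Simon I, Thm. VI.16, the Hilbert–Schmidt
theorem, and its proof). [cite: ReedSimonI1980, Thm. VI.16] -/
theorem exists_eigenvector_norm_of_re_inner_nonneg [Nontrivial G] {T : G →L[𝕜] G}
    (hT : IsSelfAdjoint T) (hTc : IsCompactOperator T)
    (hpos : ∀ x : G, 0 ≤ RCLike.re ⟪x, T x⟫_𝕜) :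
    ∃ Ω : G, ‖Ω‖ = 1 ∧ T Ω = ((‖T‖ : ℝ) : 𝕜) • Ω := by
  by_cases hT0 : T = 0
  · obtain ⟨x, hx⟩ := exists_ne (0 : G)
    refine ⟨(‖x‖⁻¹ : 𝕜) • x, norm_smul_inv_norm hx, ?_⟩
    subst hT0
    simp
  have hTn : ‖T‖ ≠ 0 := norm_ne_zero_iff.mpr hT0
  -- the Rayleigh quotient `Re ⟪T x, x⟫ / ‖x‖²` is nonnegative
  have hray : ∀ x : G, 0 ≤ T.rayleighQuotient x := fun x => by
    rw [ContinuousLinearMap.rayleighQuotient, ContinuousLinearMap.reApplyInnerSelf_apply,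
      inner_re_symm]
    exact div_nonneg (hpos x) (sq_nonneg _)
  -- `‖T‖` lies in the spectrum of `T`
  have hmem : ((‖T‖ : ℝ) : 𝕜) ∈ spectrum 𝕜 T := by
    by_contra hres
    have hres' : algebraMap ℝ 𝕜 ‖T‖ ∈ resolventSet 𝕜 T := by
      rw [spectrum.mem_resolventSet_iff]
      rwa [spectrum.mem_iff, not_not] at hres
    obtain ⟨ε, hε, hεle⟩ := T.rayleighQuotient_le_of_norm_mem_resolventSet hres'
    have hsup := T.norm_eq_iSup_rayleighQuotient hT.isSymmetric
    have : ‖T‖ ≤ ‖T‖ - ε := by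
      refine hsup.le.trans (ciSup_le fun x => ?_)
      rw [abs_of_nonneg (hray x)]
      exact hεle x
    linarith
  have hev : Module.End.HasEigenvalue (T : Module.End 𝕜 G) ((‖T‖ : ℝ) : 𝕜) :=
    (IsCompactOperator.hasEigenvalue_iff_mem_spectrum hTc (RCLike.ofReal_ne_zero.2 hTn)).mpr
      hmem
  obtain ⟨v, hv⟩ := hev.exists_hasEigenvector
  have hv0 : v ≠ 0 := hv.2
  have hTv : T v = ((‖T‖ : ℝ) : 𝕜) • v := hv.apply_eq_smul
  refine ⟨(‖v‖⁻¹ : 𝕜) • v, norm_smul_inv_norm hv0, ?_⟩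
  rw [map_smul, hTv, smul_comm]

end General

/-- **Level `0` of the min–max principle for a compact positive self-adjoint operator.** Let `T`
be compact, self-adjoint and positive as a form (`0 ≤ Re ⟪x, T x⟫`) on a nontrivial Hilbert
space `G`, and `D ⊆ G` a dense subspace. With `λ₀ = sup {Re ⟪ψ, T ψ⟫ / ‖ψ‖² : ψ ∈ D, ψ ≠ 0}`
there is a unit vector `Ω` with `T Ω = λ₀ Ω`, and `Re ⟪x, T x⟫ ≤ λ₀ ‖x‖²` for all `x ∈ G` (so
`λ₀ = ‖T‖ = max σ(T)` is the top eigenvalue; Reed–Simon IV, Thm. XIII.1, with Reed–Simon I,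
Thm. VI.16). [cite: ReedSimonIV1978, Thm. XIII.1] -/
theorem exists_top_eigenvector_of_dense : ∀ {𝕜 : Type*} [RCLike 𝕜] {G : Type*}
    [NormedAddCommGroup G] [InnerProductSpace 𝕜 G] [CompleteSpace G] [Nontrivial G]
    (T : G →L[𝕜] G), IsSelfAdjoint T → IsCompactOperator T →
    (∀ x : G, 0 ≤ RCLike.re ⟪x, T x⟫_𝕜) → ∀ (D : Submodule 𝕜 G), Dense (D : Set G) →
    ∃ Ω : G, ‖Ω‖ = 1 ∧
      T Ω = ((sSup ((fun ψ : G => RCLike.re ⟪ψ, T ψ⟫_𝕜 / ‖ψ‖ ^ 2) ''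
        {ψ | ψ ∈ D ∧ ψ ≠ 0}) : ℝ) : 𝕜) • Ω ∧
      ∀ x : G, RCLike.re ⟪x, T x⟫_𝕜 ≤
        sSup ((fun ψ : G => RCLike.re ⟪ψ, T ψ⟫_𝕜 / ‖ψ‖ ^ 2) '' {ψ | ψ ∈ D ∧ ψ ≠ 0}) *
          ‖x‖ ^ 2 := by
  intro 𝕜 _ G _ _ _ _ T hT hTc hpos D hD
  obtain ⟨Ω, hΩ, hTΩ⟩ := exists_eigenvector_norm_of_re_inner_nonneg hT hTc hpos
  have hle : ∀ x : G, RCLike.re ⟪x, T x⟫_𝕜 ≤ ‖T‖ * ‖x‖ ^ 2 :=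
    re_inner_apply_le_norm_mul_sq T
  rw [csSup_rayleigh_eq_of_dense hΩ hTΩ hle hD]
  exact ⟨Ω, hΩ, hTΩ, hle⟩

end Literature.Analysis.OperatorTheory

end
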